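import Literature.Computability.Complexity.CHSums
import HarnessLib

/-!
# The bits of an iterated sum: column counts, blocks, and carry look-ahead

Arithmetic core (theorems only, no complexity) of the constant-depth iterated-addition
algorithm, in the form in which it is scaled up to the counting hierarchy
(`CHIteratedAddition.lean`; Bürgisser, ECCC TR06-113, proof of Thm. 3.7(1): "iterated addition …
is well known to be in Dlogtime-uniform `TC⁰` … by scaling up this result … we obtain the claim";
Vollmer 1999, Thm. 1.20 / Chandra–Stockmeyer–Vishkin 1984):

* `sum_eq_sum_two_pow_mul_card`: `∑ᵢ Gᵢ = ∑ⱼ 2ʲ cⱼ` with the column counts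
  `cⱼ = #{i | bit j of Gᵢ}`;
* blocks of length `L`: `T_β = ∑_{m<L} 2ᵐ c_{Lβ+m} = ∑ᵢ (⌊Gᵢ / 2^{Lβ}⌋ mod 2ᴸ)` (a sum of WINDOWS,
  `blockSum_eq_sum_window`), and `∑ⱼ 2ʲ cⱼ = ∑_β 2^{Lβ} T_β = E + O` with the even blocks `E` and
  the odd blocks `O`, whose binary digits do not overlap when `T_β < 2^{2L}`
  (`testBit_sum_two_pow_mul_digit`: bits of a base-`2ᴷ` expansion);
* `testBit_add_eq_xor_carry`: carry look-ahead, `bit_t(a + b) = aₜ ⊕ bₜ ⊕ carryₜ` with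
  `carryₜ ↔ ∃ s < t, (aₛ ∧ bₛ) ∧ ∀ u < t, s < u → (aᵤ ∨ bᵤ)` (generate / alive);
* the package `testBit_sum_eq_blocks`: bit `t` of `∑_{i<N} Gᵢ` (`N ≤ 2ᴸ`) expressed through the
  bits `eₜ, oₜ` read off the block sums `T_β` and the carry formula — the shape realised by a
  constant number of counting / first-order steps.

## References

* H. Vollmer, *Introduction to Circuit Complexity* (1999), §1.1 (carry look-ahead), Thm. 1.20.
* A. K. Chandra, L. Stockmeyer, U. Vishkin, *Constant depth reducibility*, SIAM J. Comput. 13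
  (1984), §3 (iterated addition in constant depth).
* P. Bürgisser, ECCC TR06-113 (2006), proof of Thm. 3.7(1).
-/

namespace Literature.Computability.Complexity

open Finset

/-! ### Column counts -/

/-- **`∑ᵢ Gᵢ = ∑ⱼ 2ʲ · #{i | bit j of Gᵢ}`** for numbers `Gᵢ < 2ᴮ` (write each `Gᵢ` in binary and
exchange the sums). [cite: Vollmer1999, Theorem 1.20] -/
theorem sum_eq_sum_two_pow_mul_card (N B : ℕ) (G : ℕ → ℕ) (hG : ∀ i < N, G i < 2 ^ B) :
    ∑ i ∈ range N, G i = ∑ j ∈ range B, 2 ^ j * ((range N).filter fun i => (G i).testBit j = true).card := by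
  have h1 : ∀ i ∈ range N, G i = ∑ j ∈ range B, 2 ^ j * ((G i).testBit j).toNat := fun i hi => by
    rw [← mod_two_pow_eq_sum_testBit, Nat.mod_eq_of_lt (hG i (mem_range.1 hi))]
  rw [sum_congr rfl h1, sum_comm]
  refine sum_congr rfl fun j _ => ?_
  rw [← mul_sum, card_filter]
  congr 1
  refine sum_congr rfl fun i _ => ?_
  cases (G i).testBit j <;> simp

/-- A block sum of column counts is a sum of windows:
`∑_{m<L} 2ᵐ · #{i | bit (Lβ+m) of Gᵢ} = ∑ᵢ (⌊Gᵢ / 2^{Lβ}⌋ mod 2ᴸ)`. [folklore] -/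
theorem blockSum_eq_sum_window (N L β : ℕ) (G : ℕ → ℕ) :
    ∑ m ∈ range L, 2 ^ m * ((range N).filter fun i => (G i).testBit (L * β + m) = true).card =
      ∑ i ∈ range N, G i / 2 ^ (L * β) % 2 ^ L := by
  have h1 : ∀ i ∈ range N, G i / 2 ^ (L * β) % 2 ^ L = ∑ m ∈ range L, 2 ^ m * ((G i).testBit (L * β + m)).toNat :=
    fun i _ => div_two_pow_mod_two_pow_eq_sum _ _ _
  rw [sum_congr rfl h1, sum_comm]
  refine sum_congr rfl fun m _ => ?_
  rw [← mul_sum, card_filter]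
  congr 1
  refine sum_congr rfl fun i _ => ?_
  cases (G i).testBit (L * β + m) <;> simp

/-- Grouping a sum over `range (L · n)` into `n` blocks of length `L`. [folklore] -/
theorem sum_range_mul_eq_sum_blocks (h : ℕ → ℕ) (L : ℕ) : ∀ n : ℕ,
    ∑ j ∈ range (L * n), h j = ∑ β ∈ range n, ∑ m ∈ range L, h (L * β + m)
  | 0 => by simp
  | n + 1 => by
    rw [show L * (n + 1) = L * n + L by ring, sum_range_add, sum_range_mul_eq_sum_blocks h L n, sum_range_succ]

/-- `∑ⱼ 2ʲ cⱼ = ∑_β 2^{Lβ} T_β` with `T_β = ∑_{m<L} 2ᵐ c_{Lβ+m}`. [folklore] -/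
theorem sum_two_pow_mul_eq_sum_blocks (c : ℕ → ℕ) (L n : ℕ) :
    ∑ j ∈ range (L * n), 2 ^ j * c j = ∑ β ∈ range n, 2 ^ (L * β) * ∑ m ∈ range L, 2 ^ m * c (L * β + m) := by
  rw [sum_range_mul_eq_sum_blocks]
  refine sum_congr rfl fun β _ => ?_
  rw [mul_sum]
  refine sum_congr rfl fun m _ => ?_
  rw [pow_add]; ring

/-! ### Bits of a base-`2ᴷ` expansion -/

/-- **Digits of a base-`2ᴷ` expansion**: if `d γ < 2ᴷ` for all `γ` and `d γ = 0` for `γ ≥ n`,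
then bit `t` of `∑_{γ<n} 2^{Kγ} d γ` is bit `t mod K` of the digit `d (t / K)`. [folklore] -/
theorem testBit_sum_two_pow_mul_digit {K : ℕ} (hK : 0 < K) :
    ∀ (n : ℕ) (d : ℕ → ℕ), (∀ γ, d γ < 2 ^ K) → (∀ γ, n ≤ γ → d γ = 0) → ∀ t : ℕ,
      (∑ γ ∈ range n, 2 ^ (K * γ) * d γ).testBit t = (d (t / K)).testBit (t % K)
  | 0, d, _, hn, t => by simp [hn (t / K) (Nat.zero_le _)]
  | n + 1, d, hd, hn, t => by
    have hsplit : ∑ γ ∈ range (n + 1), 2 ^ (K * γ) * d γ =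
        2 ^ K * (∑ γ ∈ range n, 2 ^ (K * γ) * d (γ + 1)) + d 0 := by
      rw [sum_range_succ', mul_sum]
      congr 1
      · refine sum_congr rfl fun γ _ => ?_
        rw [show K * (γ + 1) = K + K * γ by ring, pow_add]; ring
      · simp
    rw [hsplit, Nat.testBit_two_pow_mul_add _ (hd 0),
      testBit_sum_two_pow_mul_digit hK n (fun γ => d (γ + 1)) (fun γ => hd _) (fun γ hγ => hn _ (by omega))]
    by_cases ht : t < K
    · rw [if_pos ht, Nat.div_eq_of_lt ht, Nat.mod_eq_of_lt ht]
    · rw [if_neg ht]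
      push Not at ht
      have h1 : (t - K) / K + 1 = t / K := by
        obtain ⟨s, rfl⟩ := Nat.exists_eq_add_of_le ht
        rw [Nat.add_sub_cancel_left, add_comm K s, Nat.add_div_right _ hK]
      have h2 : (t - K) % K = t % K := by
        obtain ⟨s, rfl⟩ := Nat.exists_eq_add_of_le ht
        rw [Nat.add_sub_cancel_left, add_comm K s, Nat.add_mod_right]
      rw [h1, h2]

/-! ### Carry look-ahead -/

section Carry

variable (a b : ℕ)

/-- Bit `t` of `a + b` is `aₜ ⊕ bₜ ⊕ cₜ` with the carry `cₜ = [a mod 2ᵗ + b mod 2ᵗ ≥ 2ᵗ]`. [cite: Vollmer1999, §1.1] -/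
theorem testBit_add_eq_xor_decide (t : ℕ) :
    (a + b).testBit t = ((a.testBit t).xor (b.testBit t)).xor (decide (2 ^ t ≤ a % 2 ^ t + b % 2 ^ t)) := by
  have ha := Nat.div_add_mod a (2 ^ t)
  have hb := Nat.div_add_mod b (2 ^ t)
  have hra := Nat.mod_lt a (Nat.two_pow_pos t)
  have hrb := Nat.mod_lt b (Nat.two_pow_pos t)
  have hdiv : (a + b) / 2 ^ t = a / 2 ^ t + b / 2 ^ t + (a % 2 ^ t + b % 2 ^ t) / 2 ^ t := by
    conv_lhs => rw [← ha, ← hb]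
    rw [show 2 ^ t * (a / 2 ^ t) + a % 2 ^ t + (2 ^ t * (b / 2 ^ t) + b % 2 ^ t) =
        (a % 2 ^ t + b % 2 ^ t) + 2 ^ t * (a / 2 ^ t + b / 2 ^ t) by ring,
      Nat.add_mul_div_left _ _ (Nat.two_pow_pos t)]
    ring
  have hc : (a % 2 ^ t + b % 2 ^ t) / 2 ^ t = if 2 ^ t ≤ a % 2 ^ t + b % 2 ^ t then 1 else 0 := by
    split_ifs with h
    · rw [Nat.div_eq_iff (Nat.two_pow_pos t)]; omega
    · exact Nat.div_eq_of_lt (by omega)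
  simp only [Nat.testBit_eq_decide_div_mod_eq, hdiv, hc]
  by_cases h1 : a / 2 ^ t % 2 = 1 <;> by_cases h2 : b / 2 ^ t % 2 = 1 <;>
    by_cases h3 : 2 ^ t ≤ a % 2 ^ t + b % 2 ^ t <;> simp [h1, h2, h3] <;> omega

/-- The full-adder recurrence of the carries: `c_{t+1} ↔ (aₜ ∧ bₜ) ∨ ((aₜ ∨ bₜ) ∧ cₜ)`. [cite: Vollmer1999, §1.1] -/
theorem carry_succ_iff (t : ℕ) :
    2 ^ (t + 1) ≤ a % 2 ^ (t + 1) + b % 2 ^ (t + 1) ↔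
      (a.testBit t = true ∧ b.testBit t = true) ∨
        ((a.testBit t = true ∨ b.testBit t = true) ∧ 2 ^ t ≤ a % 2 ^ t + b % 2 ^ t) := by
  rw [Nat.mod_pow_succ, Nat.mod_pow_succ, ← Nat.toNat_testBit, ← Nat.toNat_testBit, pow_succ]
  have hra := Nat.mod_lt a (Nat.two_pow_pos t)
  have hrb := Nat.mod_lt b (Nat.two_pow_pos t)
  cases a.testBit t <;> cases b.testBit t <;> simp <;> omega

/-- **Carry look-ahead**: the carry into position `t` is on iff some position `s < t` generates
(`aₛ = bₛ = 1`) and every position strictly between `s` and `t` is alive (`aᵤ = 1` or `bᵤ = 1`). [cite: Vollmer1999, §1.1] -/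
theorem carry_iff_exists (t : ℕ) :
    2 ^ t ≤ a % 2 ^ t + b % 2 ^ t ↔
      ∃ s < t, (a.testBit s = true ∧ b.testBit s = true) ∧
        ∀ u < t, s < u → (a.testBit u = true ∨ b.testBit u = true) := by
  induction t with
  | zero => simp [Nat.mod_one]
  | succ t ih =>
    rw [carry_succ_iff, ih]
    constructor
    · rintro (hg | ⟨hp, s, hs, hgs, hall⟩)
      · exact ⟨t, Nat.lt_succ_self t, hg, fun u hu' hu => absurd hu' (by omega)⟩
      · refine ⟨s, Nat.lt_succ_of_lt hs, hgs, fun u hu' hu => ?_⟩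
        rcases Nat.lt_succ_iff_lt_or_eq.1 hu' with h | rfl
        · exact hall u h hu
        · exact hp
    · rintro ⟨s, hs, hgs, hall⟩
      rcases Nat.lt_succ_iff_lt_or_eq.1 hs with h | rfl
      · exact Or.inr ⟨hall t (Nat.lt_succ_self t) h, s, h, hgs, fun u hu' hu => hall u (Nat.lt_succ_of_lt hu') hu⟩
      · exact Or.inl hgs

/-- **Bits of a sum of two numbers by carry look-ahead**:
`bit_t(a + b) = aₜ ⊕ bₜ ⊕ [∃ s < t, aₛ ∧ bₛ ∧ ∀ u ∈ (s,t), aᵤ ∨ bᵤ]`. [cite: Vollmer1999, §1.1] -/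
theorem testBit_add_eq_xor_carry (t : ℕ) :
    (a + b).testBit t = ((a.testBit t).xor (b.testBit t)).xor
      (decide (∃ s < t, (a.testBit s = true ∧ b.testBit s = true) ∧
        ∀ u < t, s < u → (a.testBit u = true ∨ b.testBit u = true))) := by
  rw [testBit_add_eq_xor_decide, decide_eq_decide.2 (carry_iff_exists a b t)]

end Carry

/-! ### The package: bits of `∑_{i<N} Gᵢ` through block sums and carries -/

section Package

variable (N L : ℕ) (G : ℕ → ℕ)

/-- The block sums `T_β = ∑_{i<N} (⌊Gᵢ / 2^{Lβ}⌋ mod 2ᴸ)` are `< 2^{2L}` when `N ≤ 2ᴸ`. [folklore] -/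
theorem blockSum_lt (hN : N ≤ 2 ^ L) (β : ℕ) : ∑ i ∈ range N, G i / 2 ^ (L * β) % 2 ^ L < 2 ^ (2 * L) := by
  calc ∑ i ∈ range N, G i / 2 ^ (L * β) % 2 ^ L ≤ ∑ _i ∈ range N, (2 ^ L - 1) :=
        sum_le_sum fun i _ => Nat.le_sub_one_of_lt (Nat.mod_lt _ (Nat.two_pow_pos L))
    _ = N * (2 ^ L - 1) := by simp
    _ ≤ 2 ^ L * (2 ^ L - 1) := Nat.mul_le_mul_right _ hN
    _ < 2 ^ (2 * L) := by
        have := Nat.two_pow_pos L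
        rw [two_mul, pow_add, Nat.mul_sub_one]
        exact Nat.sub_lt (Nat.mul_pos this this) this

/-- The block sums vanish beyond the length of all summands: if `Gᵢ < 2^{Lβ}` for all `i < N` then
`T_β = 0`. [folklore] -/
theorem blockSum_eq_zero {β : ℕ} (h : ∀ i < N, G i < 2 ^ (L * β)) : ∑ i ∈ range N, G i / 2 ^ (L * β) % 2 ^ L = 0 :=
  sum_eq_zero fun i hi => by rw [Nat.div_eq_of_lt (h i (mem_range.1 hi)), Nat.zero_mod]

/-- **Bits of an iterated sum through blocks and carries.** Let `0 < L`, `N ≤ 2ᴸ`, and let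
`T_β = ∑_{i<N} (⌊Gᵢ / 2^{Lβ}⌋ mod 2ᴸ)` be the block sums (each `< 2^{2L}`). With the even-block bits
`eₜ = bit (t mod 2L) of T_{2⌊t/2L⌋}` and the odd-block bits
`oₜ = [L ≤ t] ∧ bit ((t-L) mod 2L) of T_{2⌊(t-L)/2L⌋+1}`, one has for every `t`:
`bit_t(∑_{i<N} Gᵢ) = eₜ ⊕ oₜ ⊕ [∃ s < t, eₛ ∧ oₛ ∧ ∀ u ∈ (s,t), eᵤ ∨ oᵤ]`.
(`∑ᵢ Gᵢ = ∑ⱼ 2ʲcⱼ = ∑_β 2^{Lβ}T_β = E + O`, the even and odd blocks having disjoint digits.) [cite: Vollmer1999, Theorem 1.20] -/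
theorem testBit_sum_eq_blocks (hL : 0 < L) (hN : N ≤ 2 ^ L) (e o : ℕ → Bool)
    (he : ∀ t, e t = (∑ i ∈ range N, G i / 2 ^ (L * (2 * (t / (2 * L)))) % 2 ^ L).testBit (t % (2 * L)))
    (ho : ∀ t, o t = (decide (L ≤ t) &&
      (∑ i ∈ range N, G i / 2 ^ (L * (2 * ((t - L) / (2 * L)) + 1)) % 2 ^ L).testBit ((t - L) % (2 * L))))
    (t : ℕ) :
    (∑ i ∈ range N, G i).testBit t = ((e t).xor (o t)).xor
      (decide (∃ s < t, (e s = true ∧ o s = true) ∧ ∀ u < t, s < u → (e u = true ∨ o u = true))) := by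
  -- a common bit-length bound `B₀` for the summands
  set M := ∑ i ∈ range N, G i with hM
  have hGM : ∀ i < N, G i < 2 ^ M := fun i hi =>
    (single_le_sum (f := G) (fun _ _ => Nat.zero_le _) (mem_range.2 hi)).trans_lt Nat.lt_two_pow_self
  set T : ℕ → ℕ := fun β => ∑ i ∈ range N, G i / 2 ^ (L * β) % 2 ^ L with hT
  have hTlt : ∀ β, T β < 2 ^ (2 * L) := blockSum_lt N L G hN
  have hT0 : ∀ β, M ≤ β → T β = 0 := fun β hβ =>
    blockSum_eq_zero N L G fun i hi => (hGM i hi).trans_le (Nat.pow_le_pow_right (by norm_num)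
      (hβ.trans (Nat.le_mul_of_pos_left β hL)))
  -- (1)+(2)+(3): `M = ∑_{β < 2M} 2^{Lβ} T_β`
  have hsum : M = ∑ β ∈ range (2 * M), 2 ^ (L * β) * T β := by
    have hB : ∀ i < N, G i < 2 ^ (L * (2 * M)) := fun i hi =>
      (hGM i hi).trans_le (Nat.pow_le_pow_right (by norm_num) (by nlinarith))
    conv_lhs => rw [hM, sum_eq_sum_two_pow_mul_card N (L * (2 * M)) G hB, sum_two_pow_mul_eq_sum_blocks]
    refine sum_congr rfl fun β _ => ?_
    rw [blockSum_eq_sum_window]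
  -- (4): even and odd blocks
  set E := ∑ γ ∈ range M, 2 ^ (2 * L * γ) * T (2 * γ) with hE
  set O' := ∑ γ ∈ range M, 2 ^ (2 * L * γ) * T (2 * γ + 1) with hO'
  have hEO : M = E + 2 ^ L * O' := by
    rw [hsum, sum_range_two_mul_eq, hE, hO', mul_sum]
    congr 1
    · refine sum_congr rfl fun γ _ => ?_
      rw [show L * (2 * γ) = 2 * L * γ by ring]
    · refine sum_congr rfl fun γ _ => ?_
      rw [show L * (2 * γ + 1) = L + 2 * L * γ by ring, pow_add]; ring
  -- (5): the digits of `E` and `O`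
  have h2L : 0 < 2 * L := by omega
  have heE : ∀ t, e t = E.testBit t := fun t => by
    rw [he, hE, testBit_sum_two_pow_mul_digit h2L M (fun γ => T (2 * γ)) (fun γ => hTlt _)
      (fun γ hγ => hT0 _ (by omega))]
  have hoO : ∀ t, o t = (2 ^ L * O').testBit t := fun t => by
    rw [ho, hO', Nat.testBit_two_pow_mul]
    by_cases hLt : L ≤ t
    · rw [decide_eq_true hLt, Bool.true_and, Bool.true_and,
        testBit_sum_two_pow_mul_digit h2L M (fun γ => T (2 * γ + 1)) (fun γ => hTlt _) (fun γ hγ => hT0 _ (by omega))]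
    · rw [decide_eq_false hLt, Bool.false_and, Bool.false_and]
  -- (6): carry look-ahead for `E + 2^L O'`
  have hfun : e = fun t => E.testBit t := funext heE
  have hfun' : o = fun t => (2 ^ L * O').testBit t := funext hoO
  rw [hEO, testBit_add_eq_xor_carry, hfun, hfun']

end Package

end Literature.Computability.Complexity
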